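import Summits.HodgeConjecture.HodgeConjecture.Theorems.F0D9opRoad2Body
-- `Cruxes/HLiu418/Lines/F0_P6a_PointwiseFrobenius.lean` EDITION 1′ (F0P6a-plan (g0): cand v1 5586b0fc37a441d2 BOX P6a-1 GREEN (F0P6-ref1 13:08:31Z)
-- MINUS `stub_PW` MINUS `pprimeEntry_holds`, on LEAD F0P6-plan RULING M-1 (E)(1) 13:15:28Z «door P″ OPENS NOW … a pure LETTER+LEMMA module»;
-- director s881 «F0P6a-plan: one pay-down sub-line BY WRITE on 24832»; REF1 WAYPOINT: `RecordCurveCongruenceOnPointsCofinal` is the documented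
-- SECOND ENTRY of the MOD boundary).  Imports the sorry-free BODY `Lines/F0D9opRoad2Body.lean` 10fde182f554a82a ONLY (never the parent
-- `F0_D9opRoad2.lean`).  ZERO `sorry`: the boundary stubs `stub_PWcore` ∕ `stub_MODquot` live in the PARENT (ED. 6) through the LEAD module `Lines/F0D9opRoad2Mod.lean` (D-0175).  No registry act: BY WRITE on stmt-HodgeConjecture-24832.

/-!
# `F0P6aPointwiseFrobenius` — ★ RE-HOME (rung-0 re-homing task, books INVENTORY §8.4 M-3; LEAD F0P6-plan (g4) «M-72») of the crux workfile `Lines/F0_P6a_PointwiseFrobenius.lean`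

This `Theorems/` module is the TREE BYTES of `Summits/HodgeConjecture/HodgeConjecture/Cruxes/HLiu418/Lines/F0_P6a_PointwiseFrobenius.lean` (edition of record,
tree sha16 e0015ae74224a8e7, 289 l., code-`sorry`-free) with the NAMESPACE KEPT — `Summit.HodgeConjecture.HodgeConjecture.Cruxes.HLiu418.F0P6aPointwiseFrobenius` — so that every
fully-qualified name (`FrobeniusDichotomy`, `finsum_eq_of_forall_eq`, `finsum_singleton_eq_of_frobeniusDichotomy`, `RecordCurvePointwiseFrobeniusDichotomyCofinal`, `deg_holds`, `congruenceOnPointsCofinal_block_of_dichotomy`, `congruenceOnPointsCofinal_of_dichotomy`; 7 declarations) is UNCHANGED; only this module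
docstring is re-headed and the `Lines` imports are switched to their ★ re-homed twins (`F0D9opRoad2Body` → `Theorems.F0D9opRoad2Body`).  Why a re-home: a `Theorems/` file cannot import a `Lines/` workfile (F0P6-ref1 o-6), and closing
stmt-HodgeConjecture-24832 `--as proved --by <Theorems decl>` at rung 0 needs the sorry-free Lines chain behind the gate (RE-HOME MAP v1.1, LA7-plan (g4),
2026-09-02; director g27 s1336 (R1)–(R3)).    Lines importers of the original: `F0D9opRoad2Mod`.
After this file is ★ the Lines workfile is meant to become a one-import SHIM of it (a `Lines/` write, batched per cone on the LEAD's word), so no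
environment ever holds two copies (NO-CROSS-IMPORT rule, «M-72» (3)).  It asserts nothing beyond what the workfile already proves.

## Original module docstring (verbatim)
## SUB-LINE `Cruxes/HLiu418/Lines/F0_P6a_PointwiseFrobenius` — the P″ ENTRY of the MOD boundary: the POINTWISE FROBENIUS DICHOTOMY
(ordinary ∕ supersingular) at the `N w + 1` translates ⇒ `F0D9opRoad2.RecordCurveCongruenceOnPointsCofinal` BY NAME

THESIS.  The road-neutral door of the ED. 5 boundary, MODv3 = `RecordCurveCongruenceOnPointsCofinal` (BODY :604–:657), asks at a cofinal neat
level `Kc` for the three-term identity of multisets of `κ̄(w)`-points `Σ_β {F red(T_{rc₁ β} x′)} = {F² red(u x′)} + (N w)·Σ_β {red(T_{rc₂ β} x′)}`.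
Since the geometric Frobenius `F` is injective on `κ̄`-points and `#(Kc t₁ Kc ∕ Kc) = N w + 1`, `Kc t₂ Kc = t₂ Kc` (LETTER DEG, ★-inhabited), the
identity at `x′` says exactly: among the `N w + 1` reductions `ȳ_β := red(T_{rc₁ β} x′)`, ONE equals `F x̄` (`x̄ := red(u x′)`) and the other `N w`
satisfy `F ȳ_β = z̄ := red(T_{rc₂} x′)` — or all `N w + 1` equal `F x̄` and `F² x̄ = z̄`.  That POINTWISE DICHOTOMY (LETTER PW below) is what a
MODULI road produces point by point, with no correspondence `𝒯`, no flatness, no open `V` (memo P″ §1 (F)(V); add2 §B3 HEART [h0]–[h7]):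
ORDINARY `x̄` — the translate by the quotient `C_can ⊂ 𝒜_x[𝔴]` lifting the connected subgroup `𝒜̄_x[𝔴]⁰` (order `N w`, unique: [h2] monogenic +
[h4]) reduces to `F x̄` ([h5] similitude `F^*λ^{(q)} = qλ`, [h6] the non-`U` side by duality, [h7] the `Z^ℚ`-coordinate), the `N w` others reduce to
`F⁻¹ z̄`; SUPERSINGULAR `x̄` — `𝒜̄_x[𝔴]` connected, all `N w + 1` quotients reduce to `F x̄` and `F² x̄ = ⟨ϖ⟩ x̄` ([h3] order bound).  Print: this is
[Liu2021] Prop. D.8 (1)–(3) + proof of Cor. D.9 (p. 139 L4–L31) read on `κ̄`-points, = [Carayol1986Compositio] §10.3, = the Eichler–Shimura ∕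
Deligne–Rapoport picture [DiamondShurman2005] Thm. 8.7.2, [KatzMazur1985] Thm. 13.4.7, [Wedhorn2000] (congruence relation, PEL case).

LOGIC (kernel-checked here): `DEG → PW → MODv3` (`congruenceOnPointsCofinal_of_dichotomy`: the finite-sum algebra `finsum_singleton_eq_of_frobeniusDichotomy`
over an index type of cardinality `N w + 1` and a subsingleton `rc₂`-index), `deg_holds : HeckeDegreeSplitPlace` PROVED by name from ★ p807687 ∕ ★ p808973
(the term of the parent՚s `stub_deg`, F0P5a-p04 (g3) CERT-DEG 9e7776af).  NO stub and NO head here (EDITION 1′, LEAD RULING M-1 (E)(1)): the LEAD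
module `Lines/F0D9opRoad2Mod.lean` imports this file, cuts PW into `RecordModuliPointwiseCoreCofinal` (XL, the MODULI CORE — P6a՚s second sub-line
`F0_P6a_ModuliDatum`, head `pwcore_holds` BY NAME: REP ∕ GEN ∕ LEV ∕ SPREAD ★ ∕ HEART + DICT) and `RecordTameLevelQuotientModel` (★-provable, hand M-Q),
proves `pw_of_core_quot` and `modv3_of_core_quot := congruenceOnPointsCofinal_of_dichotomy deg_holds (pw_of_core_quot …)`, and the PARENT ED. 6 carries
the two registered-to-be stubs `stub_PWcore` ∕ `stub_MODquot` with `stub_MODv3 := modv3_of_core_quot stub_PWcore stub_MODquot`.  WHY THIS SHAPE: PW is MODv3 with the multiset∕`finsum`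
language and the degree bookkeeping REMOVED and the two mechanisms (canonical subgroup ∕ supersingular) EXPOSED — the statement the finite-group-scheme
algebra of the HEART concludes translate by translate; it is equivalent to MODv3 given DEG and the injectivity of `F` on `κ̄`-points (so no strength is
lost or smuggled), and strictly below the print-shape boundary `stub_MOD` (MODv2 ⇒ MODv3 ⇒ PW-content, never conversely).
HC_CM is proved only modulo the 2 remaining named inputs (hLiu418 24832, h413 24833) — behind them the booked printed statements + the MOD package —
until rung 0 closes; this file changes no count. -/

namespace Summit.HodgeConjecture.HodgeConjecture.Cruxes.HLiu418.F0P6aPointwiseFrobenius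

set_option linter.dupNamespace false  -- `Summit.HodgeConjecture.HodgeConjecture.…` BY DESIGN (D-0017), as in `Lines/d6_cm_curve.lean`

open CategoryTheory NumberField IsDedekindDomain MulAction
open scoped Matrix
open Literature.NumberTheory.GaloisRepresentations
open Literature.NumberTheory.Automorphic Literature.NumberTheory.Automorphic.UnitaryGroup
open Literature.AlgebraicGeometry.ShimuraVarieties.UnitaryCanonicalModel
open Literature.NumberTheory.Automorphic.Liu2021.AppendixC
open Literature.AlgebraicGeometry.Motives (AlgPoints IntegralModel frobeniusOver SchemeOver)
open Literature.NumberTheory.DiophantineGeometry (geomResidueField)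
open Literature.NumberTheory.EllipticCurves (genericFibre)
open Summit.HodgeConjecture.HodgeConjecture.Cruxes.HLiu418.F0D9opRoad2 (RecordCurveCongruenceOnPointsCofinal HeckeDegreeSplitPlace)

/-! ### §0 The pointwise dichotomy as a generic predicate, and its finite-sum algebra -/

/-- **The pointwise Frobenius dichotomy** for a self-map `Fr` of a type of points `P` (geometric Frobenius on `κ̄`-points), a point `xbar`
(the reduction of `u x′`), a family `y : κ₁ → P` (the reductions of the `T(w)`-translates, indexed by `Kc t₁ Kc ∕ Kc`) and a family `z : κ₂ → P`
(the reductions of the `⟨ϖ⟩`-translates, indexed by the singleton `Kc t₂ Kc ∕ Kc`): EITHER (ordinary) some index `β₀` has `y β₀ = Fr xbar` and every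
OTHER translate satisfies `Fr (y β) = z β₂`, OR (supersingular) every translate equals `Fr xbar` and `Fr (Fr xbar) = z β₂`.
[cite: Liu2021, Prop. D.8 (1)–(3) p. 135 and proof of Cor. D.9 p. 139] [cite: DiamondShurman2005, Thm. 8.7.2 p. 353] -/
def FrobeniusDichotomy {P κ₁ κ₂ : Type*} (Fr : P → P) (xbar : P) (y : κ₁ → P) (z : κ₂ → P) : Prop :=
  (∃ β₀ : κ₁, y β₀ = Fr xbar ∧ ∀ β : κ₁, β ≠ β₀ → ∀ β₂ : κ₂, Fr (y β) = z β₂) ∨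
    ((∀ β : κ₁, y β = Fr xbar) ∧ ∀ β₂ : κ₂, Fr (Fr xbar) = z β₂)

/-- `∑ᶠ` over a type all of whose elements equal `i₀` is the value at `i₀` (copy of the parent line՚s private folklore lemma). [folklore] -/
private theorem finsum_eq_of_forall_eq {κ M : Type*} [AddCommMonoid M] (i₀ : κ) (h : ∀ i, i = i₀) (f : κ → M) :
    ∑ᶠ i, f i = f i₀ := by
  haveI : Unique κ := ⟨⟨i₀⟩, h⟩
  exact (finsum_unique f).trans (congrArg f (h _))

/-- **The three-term identity from the dichotomy** (pure algebra): over an index type `κ₁` with `q + 1` elements and a subsingleton-with-point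
index type `κ₂`, the dichotomy gives `Σ_β {Fr (y β)} = {Fr (Fr xbar)} + Σ_{β₂} q • {z β₂}` as multisets — ordinary: one term `{Fr (Fr xbar)}` and
`q` terms `{z β₂₀}`; supersingular: `q + 1` copies of `{Fr (Fr xbar)} = {z β₂₀}`. [folklore] -/
theorem finsum_singleton_eq_of_frobeniusDichotomy {P κ₁ κ₂ : Type*} [Finite κ₁] (Fr : P → P) (xbar : P) (y : κ₁ → P)
    (z : κ₂ → P) (q : ℕ) (hcard : Nat.card κ₁ = q + 1) (β₂₀ : κ₂) (hκ₂ : ∀ β₂ : κ₂, β₂ = β₂₀)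
    (h : FrobeniusDichotomy Fr xbar y z) :
    ∑ᶠ β, ({Fr (y β)} : Multiset P) = {Fr (Fr xbar)} + ∑ᶠ β₂, q • ({z β₂} : Multiset P) := by
  classical
  haveI := Fintype.ofFinite κ₁
  rw [finsum_eq_of_forall_eq β₂₀ hκ₂, finsum_eq_sum_of_fintype]
  have hcardF : Fintype.card κ₁ = q + 1 := by rw [← Nat.card_eq_fintype_card, hcard]
  rcases h with ⟨β₀, hβ₀, hrest⟩ | ⟨hall, hss⟩
  · -- ordinary: split off the term at `β₀`
    rw [← Finset.add_sum_erase (Finset.univ : Finset κ₁) _ (Finset.mem_univ β₀), hβ₀]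
    have hconst : ∀ β ∈ (Finset.univ : Finset κ₁).erase β₀, ({Fr (y β)} : Multiset P) = {z β₂₀} := by
      intro β hβ
      rw [hrest β (Finset.ne_of_mem_erase hβ) β₂₀]
    rw [Finset.sum_congr rfl hconst, Finset.sum_const, Finset.card_erase_of_mem (Finset.mem_univ β₀), Finset.card_univ,
      hcardF, Nat.add_sub_cancel]
  · -- supersingular: all `q + 1` terms coincide
    have hconst : ∀ β ∈ (Finset.univ : Finset κ₁), ({Fr (y β)} : Multiset P) = {Fr (Fr xbar)} := by
      intro β _
      rw [hall β]
    rw [Finset.sum_congr rfl hconst, Finset.sum_const, Finset.card_univ, hcardF, ← hss β₂₀, add_comm q 1, add_nsmul, one_nsmul]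

/-! ### §1 LETTER PW — the pointwise Frobenius dichotomy at a cofinal neat level (the P″ entry՚s boundary) -/

/-- **LETTER PW — `RecordCurvePointwiseFrobeniusDichotomyCofinal`** (F0P6a-plan (g0), 2026-09-01): the binder block of MODv3
`F0D9opRoad2.RecordCurveCongruenceOnPointsCofinal` (BODY :604–:646) TOKEN-FOR-TOKEN — record datum, small level `K`, `∃ S₃(K)` finite, split
`w ∉ S₃` with `J⋆_w ∈ GL₂(𝒪_w)` and `K` hyperspecial at `w|_{F⁺}`, (α) smooth proper `𝒮` of `M⋆_K` over `𝒪_{F,(w)}`, (β′) `Kc ≤ K` hyperspecial,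
smooth proper `𝒮c` of `M⋆_{Kc}`, `ū : 𝒮c ⟶ 𝒮` over `u_{Kc→K}`, and for every `N′ ≤ Kc`, coset families `rc₁ rc₂` of `Kc t₁ Kc ∕ Kc`, `Kc t₂ Kc ∕ Kc`
admissible at `N′`, every `x′ ∈ M⋆_{N′}(Ω)` — followed, INSTEAD of the three-term multiset identity, by the POINTWISE FROBENIUS DICHOTOMY
(`FrobeniusDichotomy`) for `F :=` geometric Frobenius on `κ̄(w)`-points of `𝒮c`, `x̄ := red(u x′)`, `ȳ_β := red(T_{rc₁ β} x′)`, `z̄_β := red(T_{rc₂ β} x′)`: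
ORDINARY — one `β₀` with `ȳ_{β₀} = F x̄` and `F ȳ_β = z̄` for every other `β`; or SUPERSINGULAR — every `ȳ_β = F x̄` and `F² x̄ = z̄`.
EQUIVALENT to MODv3 given LETTER DEG and the injectivity of `F` on `κ̄`-points; implied by the print-shape boundary MODv2; inhabited by the P″
road (MODULI Rows 1–3, 6 + SPREAD ★ + DICT + HEART [h0]–[h7]) WITHOUT the correspondence `𝒯`.  XL.  NOT asserted here: the registered-to-be stub below.
(print: Liu2021, Prop. D.8 (1)–(3) p. 135 and proof of Cor. D.9 p. 139 L4–L31) (print: Carayol1986Compositio, §10.3 p. 210)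
(print: DiamondShurman2005, Thm. 8.7.2 p. 353) (print: KatzMazur1985, Thm. 13.4.7) (print: Wedhorn2000CongruenceRelation, Thm. p. 2) -/
def RecordCurvePointwiseFrobeniusDichotomyCofinal : Prop :=
  ∀ (F : Type) [Field F] [NumberField F] [IsCMField F] [IsGalois ℚ F] (ι₁ : F →+* ℂ)
    (Jstar : Matrix (Fin 2) (Fin 2) F)
    (K₀ : C5.OpenCompactSubgroup ↥(finAdelic ↥(maximalRealSubfield F) F (IsCMField.complexConj F) 2 Jstar))
    (S : RecordSystemGS F Jstar ι₁ K₀) (hU7ₛ : S.HeckeTranslateDefinedOver)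
    (hJ : (Jstar.map (IsCMField.complexConj F))ᵀ = Jstar) (hJu : IsUnit Jstar) (K : C5.SmallLevel K₀),
    ∃ S₃ : Set (HeightOneSpectrum (𝓞 F)), S₃.Finite ∧
      ∀ w : HeightOneSpectrum (𝓞 F), w ∉ S₃ → ∀ hw : (IsCMField.complexConj F) • w ≠ w,
        (UnitaryGroup.isUnit_placeForm Jstar hJu w).unit ∈ glInt 2 (w.adicCompletion F) →
          UnitaryGroup.IsHyperspecialAt ↥(maximalRealSubfield F) F (IsCMField.complexConj F) 2 Jstar K.1.1
            (w.under (𝓞 ↥(maximalRealSubfield F))) →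
          ∃ (𝒮 : IntegralModel (HeightOneSpectrum.valuationSubringAtPrime F w) F (S.M.obj K)) (_h𝒮 : 𝒮.IsSmoothProper 1)
            (Kc : C5.SmallLevel K₀) (hKcK : Kc ≤ K)
            (_hKc : UnitaryGroup.IsHyperspecialAt ↥(maximalRealSubfield F) F (IsCMField.complexConj F) 2 Jstar Kc.1.1
               (w.under (𝓞 ↥(maximalRealSubfield F))))
            (𝒮c : IntegralModel (HeightOneSpectrum.valuationSubringAtPrime F w) F (S.M.obj Kc)) (h𝒮c : 𝒮c.IsSmoothProper 1)
            (ū : 𝒮c.total ⟶ 𝒮.total)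
            (_hū : (genericFibre (HeightOneSpectrum.valuationSubringAtPrime F w) F).map ū ≫ 𝒮.genericIso'.hom
               = 𝒮c.genericIso'.hom ≫ S.M.map (homOfLE hKcK)),
           haveI : AlgebraicGeometry.IsProper 𝒮c.total.hom := h𝒮c.2
           ∀ (N' : C5.SmallLevel K₀) (hN'Kc : N' ≤ Kc)
             (rc₁ : orbit (Kc.1.1 : Subgroup ↥(finAdelic ↥(maximalRealSubfield F) F (IsCMField.complexConj F) 2 Jstar))
                  ((UnitaryGroup.heckeElementAt ↥(maximalRealSubfield F) F (IsCMField.complexConj F) 2 Jstar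
                      (⟨w, rfl⟩ : UnitaryGroup.PlacesOver F (w.under (𝓞 ↥(maximalRealSubfield F))))
                      (IsCMField.complexConj_ne_one F) hJ hw (UnitaryGroup.isUnit_placeForm Jstar hJu w) (HeckeCharacter.uniformizer F w) 1 :
                    ↥(finAdelic ↥(maximalRealSubfield F) F (IsCMField.complexConj F) 2 Jstar)) :
                    ↥(finAdelic ↥(maximalRealSubfield F) F (IsCMField.complexConj F) 2 Jstar) ⧸
                      (Kc.1.1 : Subgroup ↥(finAdelic ↥(maximalRealSubfield F) F (IsCMField.complexConj F) 2 Jstar))) →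
                ↥(finAdelic ↥(maximalRealSubfield F) F (IsCMField.complexConj F) 2 Jstar)),
             (∀ β, ((rc₁ β : ↥(finAdelic ↥(maximalRealSubfield F) F (IsCMField.complexConj F) 2 Jstar)) :
                 ↥(finAdelic ↥(maximalRealSubfield F) F (IsCMField.complexConj F) 2 Jstar) ⧸
                   (Kc.1.1 : Subgroup ↥(finAdelic ↥(maximalRealSubfield F) F (IsCMField.complexConj F) 2 Jstar))) = β.1) →
             ∀ (hrcN₁ : ∀ β, C5.HeckeLE (rc₁ β) N' Kc)
               (rc₂ : orbit (Kc.1.1 : Subgroup ↥(finAdelic ↥(maximalRealSubfield F) F (IsCMField.complexConj F) 2 Jstar))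
                  ((UnitaryGroup.heckeElementAt ↥(maximalRealSubfield F) F (IsCMField.complexConj F) 2 Jstar
                      (⟨w, rfl⟩ : UnitaryGroup.PlacesOver F (w.under (𝓞 ↥(maximalRealSubfield F))))
                      (IsCMField.complexConj_ne_one F) hJ hw (UnitaryGroup.isUnit_placeForm Jstar hJu w) (HeckeCharacter.uniformizer F w) 2 :
                    ↥(finAdelic ↥(maximalRealSubfield F) F (IsCMField.complexConj F) 2 Jstar)) :
                    ↥(finAdelic ↥(maximalRealSubfield F) F (IsCMField.complexConj F) 2 Jstar) ⧸
                      (Kc.1.1 : Subgroup ↥(finAdelic ↥(maximalRealSubfield F) F (IsCMField.complexConj F) 2 Jstar))) →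
                ↥(finAdelic ↥(maximalRealSubfield F) F (IsCMField.complexConj F) 2 Jstar)),
             (∀ β, ((rc₂ β : ↥(finAdelic ↥(maximalRealSubfield F) F (IsCMField.complexConj F) 2 Jstar)) :
                 ↥(finAdelic ↥(maximalRealSubfield F) F (IsCMField.complexConj F) 2 Jstar) ⧸
                   (Kc.1.1 : Subgroup ↥(finAdelic ↥(maximalRealSubfield F) F (IsCMField.complexConj F) 2 Jstar))) = β.1) →
             ∀ (hrcN₂ : ∀ β, C5.HeckeLE (rc₂ β) N' Kc),
             ∀ x' : AlgPoints (S.M.obj N') (AlgebraicClosure (w.adicCompletion F)),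
               FrobeniusDichotomy (P := AlgPoints 𝒮c.reductionAt (geomResidueField w))
                 (AlgPoints.map (frobeniusOver 𝒮c.reductionAt))
                 (𝒮c.geomReductionMap (AlgPoints.map (S.M.map (homOfLE hN'Kc)) x'))
                 (fun β => 𝒮c.geomReductionMap (AlgPoints.map (recordHeckeTranslateGS S hU7ₛ (rc₁ β) N' Kc (hrcN₁ β)) x'))
                 (fun β => 𝒮c.geomReductionMap (AlgPoints.map (recordHeckeTranslateGS S hU7ₛ (rc₂ β) N' Kc (hrcN₂ β)) x'))

/-! ### §2 LETTER DEG inhabited by name (the parent՚s `stub_deg` term; ★ p807687 ∕ ★ p808973) -/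

/-- **`deg_holds : HeckeDegreeSplitPlace` — PROVED** by name from ★ p807687 `Literature/NumberTheory/Automorphic/UnitaryGroupHeckeDegreeSplitPlace.lean`
(clause (a) `natCard_orbit_heckeElementAt_one_uniformizer`) and ★ p808973 `Literature/NumberTheory/Automorphic/UnitaryGroupHeckeCentralElement.lean`
(clauses (b)(c)); the term of the parent line՚s `stub_deg` (F0P5a-p04 (g3) CERT-DEG-letter-holds 9e7776af, REF1 countersign 2026-08-31T03:53:01Z) verbatim.
[cite: Shimura1971, Prop. 3.33] [cite: DiamondShurman2005, §5.2 eq. (5.3)] -/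
theorem deg_holds : HeckeDegreeSplitPlace := by
  intro F _ _ _ _ Jstar hJ hJu K w hw hJi hK
  exact ⟨UnitaryGroup.natCard_orbit_heckeElementAt_one_uniformizer hK ⟨w, rfl⟩ (IsCMField.complexConj_ne_one F) hJ hw
      (UnitaryGroup.isUnit_placeForm Jstar hJu w) hJi,
    fun α => UnitaryGroup.coe_eq_of_mem_orbit_heckeElementAt_self K ⟨w, rfl⟩ (IsCMField.complexConj_ne_one F) hJ hw
      (UnitaryGroup.isUnit_placeForm Jstar hJu w) (HeckeCharacter.uniformizer F w) α,
    fun k hk => UnitaryGroup.inv_mul_mul_heckeElementAt_self_mem K ⟨w, rfl⟩ (IsCMField.complexConj_ne_one F) hJ hw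
      (UnitaryGroup.isUnit_placeForm Jstar hJu w) (HeckeCharacter.uniformizer F w) hk⟩

/-! ### §3 The composition `DEG → PW → MODv3`, kernel-checked (the LEAD module `F0D9opRoad2Mod` composes it with `deg_holds`) -/

/-- **The (γ″) block of MODv3 at `(Kc, 𝒮c)` from the dichotomy block of PW at `(Kc, 𝒮c)` and DEG** (a Π-lemma, so that the composition
below closes by ONE anonymous constructor — the parent line՚s `∃`-plumbing discipline: no `fun … => ?_` inside `refine`, no trailing `?_` under
the 9-deep constructor): at `(N′, rc₁, rc₂, x′)` the identity IS `finsum_singleton_eq_of_frobeniusDichotomy` with `#(Kc t₁ Kc ∕ Kc) = N w + 1`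
(DEG (a)) and `Kc t₂ Kc ∕ Kc = {t₂ Kc}` (DEG (b)). [cite: Liu2021, proof of Cor. D.9 p. 139 L4–L31] [cite: DiamondShurman2005, Thm. 8.7.2 p. 353] -/
theorem congruenceOnPointsCofinal_block_of_dichotomy (hDEG : HeckeDegreeSplitPlace)
    (F : Type) [Field F] [NumberField F] [IsCMField F] [IsGalois ℚ F] (ι₁ : F →+* ℂ)
    (Jstar : Matrix (Fin 2) (Fin 2) F)
    (K₀ : C5.OpenCompactSubgroup ↥(finAdelic ↥(maximalRealSubfield F) F (IsCMField.complexConj F) 2 Jstar))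
    (S : RecordSystemGS F Jstar ι₁ K₀) (hU7ₛ : S.HeckeTranslateDefinedOver)
    (hJ : (Jstar.map (IsCMField.complexConj F))ᵀ = Jstar) (hJu : IsUnit Jstar)
    (w : HeightOneSpectrum (𝓞 F)) (hw : (IsCMField.complexConj F) • w ≠ w)
    (hJi : (UnitaryGroup.isUnit_placeForm Jstar hJu w).unit ∈ glInt 2 (w.adicCompletion F))
    (Kc : C5.SmallLevel K₀)
    (hKc : UnitaryGroup.IsHyperspecialAt ↥(maximalRealSubfield F) F (IsCMField.complexConj F) 2 Jstar Kc.1.1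
      (w.under (𝓞 ↥(maximalRealSubfield F))))
    (𝒮c : IntegralModel (HeightOneSpectrum.valuationSubringAtPrime F w) F (S.M.obj Kc)) [AlgebraicGeometry.IsProper 𝒮c.total.hom]
    (hPW₁ :
           ∀ (N' : C5.SmallLevel K₀) (hN'Kc : N' ≤ Kc)
             (rc₁ : orbit (Kc.1.1 : Subgroup ↥(finAdelic ↥(maximalRealSubfield F) F (IsCMField.complexConj F) 2 Jstar))
                  ((UnitaryGroup.heckeElementAt ↥(maximalRealSubfield F) F (IsCMField.complexConj F) 2 Jstar
                      (⟨w, rfl⟩ : UnitaryGroup.PlacesOver F (w.under (𝓞 ↥(maximalRealSubfield F))))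
                      (IsCMField.complexConj_ne_one F) hJ hw (UnitaryGroup.isUnit_placeForm Jstar hJu w) (HeckeCharacter.uniformizer F w) 1 :
                    ↥(finAdelic ↥(maximalRealSubfield F) F (IsCMField.complexConj F) 2 Jstar)) :
                    ↥(finAdelic ↥(maximalRealSubfield F) F (IsCMField.complexConj F) 2 Jstar) ⧸
                      (Kc.1.1 : Subgroup ↥(finAdelic ↥(maximalRealSubfield F) F (IsCMField.complexConj F) 2 Jstar))) →
                ↥(finAdelic ↥(maximalRealSubfield F) F (IsCMField.complexConj F) 2 Jstar)),
             (∀ β, ((rc₁ β : ↥(finAdelic ↥(maximalRealSubfield F) F (IsCMField.complexConj F) 2 Jstar)) :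
                 ↥(finAdelic ↥(maximalRealSubfield F) F (IsCMField.complexConj F) 2 Jstar) ⧸
                   (Kc.1.1 : Subgroup ↥(finAdelic ↥(maximalRealSubfield F) F (IsCMField.complexConj F) 2 Jstar))) = β.1) →
             ∀ (hrcN₁ : ∀ β, C5.HeckeLE (rc₁ β) N' Kc)
               (rc₂ : orbit (Kc.1.1 : Subgroup ↥(finAdelic ↥(maximalRealSubfield F) F (IsCMField.complexConj F) 2 Jstar))
                  ((UnitaryGroup.heckeElementAt ↥(maximalRealSubfield F) F (IsCMField.complexConj F) 2 Jstar
                      (⟨w, rfl⟩ : UnitaryGroup.PlacesOver F (w.under (𝓞 ↥(maximalRealSubfield F))))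
                      (IsCMField.complexConj_ne_one F) hJ hw (UnitaryGroup.isUnit_placeForm Jstar hJu w) (HeckeCharacter.uniformizer F w) 2 :
                    ↥(finAdelic ↥(maximalRealSubfield F) F (IsCMField.complexConj F) 2 Jstar)) :
                    ↥(finAdelic ↥(maximalRealSubfield F) F (IsCMField.complexConj F) 2 Jstar) ⧸
                      (Kc.1.1 : Subgroup ↥(finAdelic ↥(maximalRealSubfield F) F (IsCMField.complexConj F) 2 Jstar))) →
                ↥(finAdelic ↥(maximalRealSubfield F) F (IsCMField.complexConj F) 2 Jstar)),
             (∀ β, ((rc₂ β : ↥(finAdelic ↥(maximalRealSubfield F) F (IsCMField.complexConj F) 2 Jstar)) :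
                 ↥(finAdelic ↥(maximalRealSubfield F) F (IsCMField.complexConj F) 2 Jstar) ⧸
                   (Kc.1.1 : Subgroup ↥(finAdelic ↥(maximalRealSubfield F) F (IsCMField.complexConj F) 2 Jstar))) = β.1) →
             ∀ (hrcN₂ : ∀ β, C5.HeckeLE (rc₂ β) N' Kc),
             ∀ x' : AlgPoints (S.M.obj N') (AlgebraicClosure (w.adicCompletion F)),
               FrobeniusDichotomy (P := AlgPoints 𝒮c.reductionAt (geomResidueField w))
                 (AlgPoints.map (frobeniusOver 𝒮c.reductionAt))
                 (𝒮c.geomReductionMap (AlgPoints.map (S.M.map (homOfLE hN'Kc)) x'))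
                 (fun β => 𝒮c.geomReductionMap (AlgPoints.map (recordHeckeTranslateGS S hU7ₛ (rc₁ β) N' Kc (hrcN₁ β)) x'))
                 (fun β => 𝒮c.geomReductionMap (AlgPoints.map (recordHeckeTranslateGS S hU7ₛ (rc₂ β) N' Kc (hrcN₂ β)) x'))) :
           ∀ (N' : C5.SmallLevel K₀) (hN'Kc : N' ≤ Kc)
             (rc₁ : orbit (Kc.1.1 : Subgroup ↥(finAdelic ↥(maximalRealSubfield F) F (IsCMField.complexConj F) 2 Jstar))
                  ((UnitaryGroup.heckeElementAt ↥(maximalRealSubfield F) F (IsCMField.complexConj F) 2 Jstar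
                      (⟨w, rfl⟩ : UnitaryGroup.PlacesOver F (w.under (𝓞 ↥(maximalRealSubfield F))))
                      (IsCMField.complexConj_ne_one F) hJ hw (UnitaryGroup.isUnit_placeForm Jstar hJu w) (HeckeCharacter.uniformizer F w) 1 :
                    ↥(finAdelic ↥(maximalRealSubfield F) F (IsCMField.complexConj F) 2 Jstar)) :
                    ↥(finAdelic ↥(maximalRealSubfield F) F (IsCMField.complexConj F) 2 Jstar) ⧸
                      (Kc.1.1 : Subgroup ↥(finAdelic ↥(maximalRealSubfield F) F (IsCMField.complexConj F) 2 Jstar))) →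
                ↥(finAdelic ↥(maximalRealSubfield F) F (IsCMField.complexConj F) 2 Jstar)),
             (∀ β, ((rc₁ β : ↥(finAdelic ↥(maximalRealSubfield F) F (IsCMField.complexConj F) 2 Jstar)) :
                 ↥(finAdelic ↥(maximalRealSubfield F) F (IsCMField.complexConj F) 2 Jstar) ⧸
                   (Kc.1.1 : Subgroup ↥(finAdelic ↥(maximalRealSubfield F) F (IsCMField.complexConj F) 2 Jstar))) = β.1) →
             ∀ (hrcN₁ : ∀ β, C5.HeckeLE (rc₁ β) N' Kc)
               (rc₂ : orbit (Kc.1.1 : Subgroup ↥(finAdelic ↥(maximalRealSubfield F) F (IsCMField.complexConj F) 2 Jstar))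
                  ((UnitaryGroup.heckeElementAt ↥(maximalRealSubfield F) F (IsCMField.complexConj F) 2 Jstar
                      (⟨w, rfl⟩ : UnitaryGroup.PlacesOver F (w.under (𝓞 ↥(maximalRealSubfield F))))
                      (IsCMField.complexConj_ne_one F) hJ hw (UnitaryGroup.isUnit_placeForm Jstar hJu w) (HeckeCharacter.uniformizer F w) 2 :
                    ↥(finAdelic ↥(maximalRealSubfield F) F (IsCMField.complexConj F) 2 Jstar)) :
                    ↥(finAdelic ↥(maximalRealSubfield F) F (IsCMField.complexConj F) 2 Jstar) ⧸
                      (Kc.1.1 : Subgroup ↥(finAdelic ↥(maximalRealSubfield F) F (IsCMField.complexConj F) 2 Jstar))) →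
                ↥(finAdelic ↥(maximalRealSubfield F) F (IsCMField.complexConj F) 2 Jstar)),
             (∀ β, ((rc₂ β : ↥(finAdelic ↥(maximalRealSubfield F) F (IsCMField.complexConj F) 2 Jstar)) :
                 ↥(finAdelic ↥(maximalRealSubfield F) F (IsCMField.complexConj F) 2 Jstar) ⧸
                   (Kc.1.1 : Subgroup ↥(finAdelic ↥(maximalRealSubfield F) F (IsCMField.complexConj F) 2 Jstar))) = β.1) →
             ∀ (hrcN₂ : ∀ β, C5.HeckeLE (rc₂ β) N' Kc),
             ∀ x' : AlgPoints (S.M.obj N') (AlgebraicClosure (w.adicCompletion F)),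
               ∑ᶠ β, ({AlgPoints.map (frobeniusOver 𝒮c.reductionAt)
                          (𝒮c.geomReductionMap (AlgPoints.map (recordHeckeTranslateGS S hU7ₛ (rc₁ β) N' Kc (hrcN₁ β)) x'))} :
                        Multiset (AlgPoints 𝒮c.reductionAt (geomResidueField w)))
                 = {AlgPoints.map (frobeniusOver 𝒮c.reductionAt) (AlgPoints.map (frobeniusOver 𝒮c.reductionAt)
                       (𝒮c.geomReductionMap (AlgPoints.map (S.M.map (homOfLE hN'Kc)) x')))}
                   + ∑ᶠ β, Ideal.absNorm w.asIdeal •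
                       ({𝒮c.geomReductionMap (AlgPoints.map (recordHeckeTranslateGS S hU7ₛ (rc₂ β) N' Kc (hrcN₂ β)) x')} :
                         Multiset (AlgPoints 𝒮c.reductionAt (geomResidueField w))) := by
  intro N' hN'Kc rc₁ hrc₁ hrcN₁ rc₂ hrc₂ hrcN₂ x'
  have hDEGx := hDEG F Jstar hJ hJu Kc.1.1 w hw hJi hKc
  obtain ⟨hdeg₁, hdeg₂, -⟩ := hDEGx
  -- the `T(w)`-index is finite of cardinality `N w + 1` (DEG (a)); the `⟨ϖ⟩`-index is the singleton `{t₂ Kc}` (DEG (b))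
  haveI := Nat.finite_of_card_ne_zero (ne_of_eq_of_ne hdeg₁ (Nat.succ_ne_zero _))
  have hκ₂ : ∀ β₂ : ↥(orbit (Kc.1.1 : Subgroup ↥(finAdelic ↥(maximalRealSubfield F) F (IsCMField.complexConj F) 2 Jstar))
      ((UnitaryGroup.heckeElementAt ↥(maximalRealSubfield F) F (IsCMField.complexConj F) 2 Jstar
          (⟨w, rfl⟩ : UnitaryGroup.PlacesOver F (w.under (𝓞 ↥(maximalRealSubfield F))))
          (IsCMField.complexConj_ne_one F) hJ hw (UnitaryGroup.isUnit_placeForm Jstar hJu w) (HeckeCharacter.uniformizer F w) 2 :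
        ↥(finAdelic ↥(maximalRealSubfield F) F (IsCMField.complexConj F) 2 Jstar)) :
        ↥(finAdelic ↥(maximalRealSubfield F) F (IsCMField.complexConj F) 2 Jstar) ⧸
          (Kc.1.1 : Subgroup ↥(finAdelic ↥(maximalRealSubfield F) F (IsCMField.complexConj F) 2 Jstar)))),
      β₂ = ⟨_, mem_orbit_self _⟩ := fun β₂ => Subtype.ext (hdeg₂ β₂)
  exact finsum_singleton_eq_of_frobeniusDichotomy _ _ _ _ (Ideal.absNorm w.asIdeal) hdeg₁ _ hκ₂
    (hPW₁ N' hN'Kc rc₁ hrc₁ hrcN₁ rc₂ hrc₂ hrcN₂ x')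

/-- **`DEG → PW → MODv3`**: the pointwise Frobenius dichotomy at a cofinal neat level implies the three-term congruence identity on points
(`F0D9opRoad2.RecordCurveCongruenceOnPointsCofinal`, BY NAME) — the witnesses `S₃, 𝒮, Kc, 𝒮c, ū` are passed through unchanged and the (γ″) block
is `congruenceOnPointsCofinal_block_of_dichotomy`. [cite: Liu2021, proof of Cor. D.9 p. 139 L4–L31] [cite: DiamondShurman2005, Thm. 8.7.2 p. 353] -/
theorem congruenceOnPointsCofinal_of_dichotomy (hDEG : HeckeDegreeSplitPlace) (hPW : RecordCurvePointwiseFrobeniusDichotomyCofinal) :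
    RecordCurveCongruenceOnPointsCofinal := by
  intro F _ _ _ _ ι₁ Jstar K₀ S hU7ₛ hJ hJu K
  obtain ⟨S₃, hS₃, hPWw⟩ := hPW F ι₁ Jstar K₀ S hU7ₛ hJ hJu K
  -- (no `fun … => ?_` inside `refine`, no trailing `?_` under the 9-deep constructor — parent line՚s §4 discipline)
  refine ⟨S₃, hS₃, ?_⟩
  intro w hwS hw hJi hK
  have hPWx := hPWw w hwS hw hJi hK
  obtain ⟨𝒮, h𝒮, Kc, hKcK, hKc, 𝒮c, h𝒮c, ū, hū, hPW₁⟩ := hPWx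
  haveI : AlgebraicGeometry.IsProper 𝒮c.total.hom := h𝒮c.2
  exact ⟨𝒮, h𝒮, Kc, hKcK, hKc, 𝒮c, h𝒮c, ū, hū,
    congruenceOnPointsCofinal_block_of_dichotomy hDEG F ι₁ Jstar K₀ S hU7ₛ hJ hJu w hw hJi Kc hKc 𝒮c hPW₁⟩

end Summit.HodgeConjecture.HodgeConjecture.Cruxes.HLiu418.F0P6aPointwiseFrobenius
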